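import Literature.AlgebraicGeometry.Resolution.Lipman1969ProperTransform
import Literature.AlgebraicGeometry.Resolution.ExceptionalCurveDegree
import Literature.AlgebraicGeometry.Resolution.ExceptionalCurvePoints
import Literature.AlgebraicGeometry.Motives.CartierDivisorProjectionFormulaCycle
import Literature.AlgebraicGeometry.Motives.RatFnBirational
import Literature.RingTheory.RegularLocalRing.QuotientDVR
import HarnessLib

/-!
# Lipman 1969 §15 a): intersection numbers with proper transforms — PROOF of the named fact

Topic: `Literature/AlgebraicGeometry/Resolution`. PROVES the named fact `Lipman1969_15_a`
(`Resolution/Lipman1969ProperTransform.lean`, Lipman 1969 §15 a), p. 227, for an integral exceptional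
curve `G = E_η` and its proper transform `G^♯ = E_{η'}`): `(g^*D · E_{η'}) = (D · E_η)`.

Proof. `g` restricts to a proper surjection `ḡ : E_{η'} → E_η` of integral proper `κ(𝔪)`-curves
(`ClosedSubvariety.exists_hom_ofPoint_fac`). The local ring `𝒪_{X,η}` is a discrete valuation ring
(`X` regular, `coheight η = 1`) with the same fraction field as the local domain `𝒪_{X',η'}` (`g`
birational), and `𝒪_{X,η} → 𝒪_{X',η'}` is local and injective, hence bijective (a DVR is a maximal
proper subring of its fraction field for domination); so `κ(η) = κ(η')`, i.e. `[R(E_{η'}) : R(E_η)] = 1`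
(`ClosedSubvariety.residueDegree_eq_finrank_of_fac`). The restriction of `g^*D` to `E_{η'}` is
linearly equivalent to `ḡ^*` of the restriction of `D` to `E_η` (functoriality of class pull-backs), and
`deg ḡ^*𝒟 = [R(E_{η'}) : R(E_η)] · deg 𝒟` by the projection formula `ḡ_*[ḡ^*𝒟] = [R(E'):R(E)] [𝒟]`
(`CartierDivisor.map_cycle_pullback_eq_smul`) and functoriality of proper push-forward. The
hypothesis `Scheme.IsRegular X'` of the named fact is not used. No new definitions.

## References

* J. Lipman, *Rational singularities, with applications to algebraic surfaces and unique factorization*,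
  Publ. Math. IHÉS 36 (1969) 195–279, §15 a) (p. 227). [Lipman1969]
* W. Fulton, *Intersection Theory*, 2nd ed. (1998), Prop. 2.3 (c), Def. 1.4. [Fulton1998]
-/

noncomputable section

open CategoryTheory AlgebraicGeometry TopologicalSpace IsLocalRing Order
open Literature.AlgebraicGeometry.Motives

universe u

namespace Literature.AlgebraicGeometry.Resolution

namespace Lipman1969_15_a_holds_aux

/-! ### A DVR dominated birationally by a local domain -/

/-- **Domination of a DVR.** An injective local homomorphism `φ : A → B` from a discrete valuation ring
to a domain such that every element of `B` is a fraction of elements of `φ(A)` is surjective. [folklore] -/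
private theorem surjective_of_dvr {A B : Type*} [CommRing A] [IsDomain A] [IsDiscreteValuationRing A]
    [CommRing B] [IsDomain B] (φ : A →+* B) [IsLocalHom φ] (hφ : Function.Injective φ)
    (hbir : ∀ b : B, ∃ a s : A, s ≠ 0 ∧ φ s * b = φ a) : Function.Surjective φ := by
  intro b
  obtain ⟨ϖ, hϖ⟩ := IsDiscreteValuationRing.exists_irreducible A
  obtain ⟨a, s, hs, h⟩ := hbir b
  have hφs : φ s ≠ 0 := (map_ne_zero_iff φ hφ).mpr hs
  by_cases ha : a = 0
  · refine ⟨0, ?_⟩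
    rw [ha, map_zero] at h
    rw [map_zero]
    exact ((mul_eq_zero.mp h).resolve_left hφs).symm
  obtain ⟨m, u, hu⟩ := IsDiscreteValuationRing.eq_unit_mul_pow_irreducible ha hϖ
  obtain ⟨n, v, hv⟩ := IsDiscreteValuationRing.eq_unit_mul_pow_irreducible hs hϖ
  by_cases hmn : n ≤ m
  · refine ⟨((u * v⁻¹ : Aˣ) : A) * ϖ ^ (m - n), ?_⟩
    apply mul_left_cancel₀ hφs
    rw [h, ← map_mul]
    congr 1
    rw [hu, hv, Units.val_mul]
    calc (v : A) * ϖ ^ n * ((u : A) * (v⁻¹ : Aˣ) * ϖ ^ (m - n))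
          = u * ((v : A) * (v⁻¹ : Aˣ)) * (ϖ ^ n * ϖ ^ (m - n)) := by ring
      _ = (u : A) * ϖ ^ m := by rw [Units.mul_inv, mul_one, ← pow_add, Nat.add_sub_cancel' hmn]
  · exfalso
    push Not at hmn
    -- `φ u · φ ϖ^m = φ v · φ ϖ^(n-m) · b · φ ϖ^m`, so the unit `φ u` is a multiple of the non-unit `φ ϖ`
    have hϖm : φ (ϖ ^ m) ≠ 0 := (map_ne_zero_iff φ hφ).mpr (pow_ne_zero _ hϖ.ne_zero)
    have key : φ (u : A) = φ (v : A) * b * φ ϖ ^ (n - m) := by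
      apply mul_right_cancel₀ hϖm
      rw [← map_mul, ← hu, ← h, hv, map_mul, map_pow,
        show n = (n - m) + m from (Nat.sub_add_cancel hmn.le).symm, pow_add, map_pow]
      simp only [Nat.add_sub_cancel]
      ring
    have hunit : IsUnit (φ ϖ ^ (n - m)) :=
      isUnit_of_mul_isUnit_right (key ▸ (Units.isUnit u).map φ)
    have hnm : n - m ≠ 0 := Nat.sub_ne_zero_of_lt hmn
    exact hϖ.not_isUnit ((isUnit_map_iff φ ϖ).mp ((isUnit_pow_iff hnm).mp hunit))

/-! ### Stalk maps of dominant / birational morphisms of integral schemes -/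

variable {X' X : Scheme.{u}} [IsIntegral X'] [IsIntegral X] (g : X' ⟶ X) [IsDominant g]

/-- The stalk maps of a dominant morphism of integral schemes are injective (they are restrictions of
the field extension `K(X) → K(X')`). [folklore] -/
private theorem stalkMap_injective (x' : X') : Function.Injective (g.stalkMap x') := by
  intro a b h
  apply RatFn.toFunctionField_injective (g.base x')
  apply (RatFn.functionFieldMap g).injective
  rw [RatFn.functionFieldMap_toFunctionField, RatFn.functionFieldMap_toFunctionField]
  exact congrArg _ h

/-- For a birational `g`, every germ on `X'` is a fraction of pulled-back germs. [folklore] -/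
private theorem exists_stalkMap_mul_eq (hbir : IsBirational g) (x' : X') (b : X'.presheaf.stalk x') :
    ∃ a s : X.presheaf.stalk (g.base x'), s ≠ 0 ∧ g.stalkMap x' s * b = g.stalkMap x' a := by
  obtain ⟨U, hU, hU', hiso⟩ := hbir
  haveI := hiso
  obtain ⟨k, hk⟩ := RatFn.functionFieldMap_surjective_of_isIso_morphismRestrict g U hU hU'
    (RatFn.toFunctionField x' b)
  obtain ⟨a, s, hs, rfl⟩ := IsFractionRing.div_surjective (A := X.presheaf.stalk (g.base x')) k
  have hs0 : s ≠ 0 := nonZeroDivisors.ne_zero hs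
  refine ⟨a, s, hs0, ?_⟩
  have hφs : RatFn.toFunctionField x' (g.stalkMap x' s) ≠ 0 :=
    (map_ne_zero_iff _ (RatFn.toFunctionField_injective x')).mpr
      ((map_ne_zero_iff _ (stalkMap_injective g x')).mpr hs0)
  rw [map_div₀] at hk
  change RatFn.functionFieldMap g (RatFn.toFunctionField _ a) /
    RatFn.functionFieldMap g (RatFn.toFunctionField _ s) = _ at hk
  rw [RatFn.functionFieldMap_toFunctionField, RatFn.functionFieldMap_toFunctionField,
    div_eq_iff hφs] at hk
  apply RatFn.toFunctionField_injective x'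
  rw [map_mul, hk, mul_comm]

/-- **Birational morphisms have residue degree one at points under which `X` has a DVR stalk**:
`𝒪_{X,g x'} → 𝒪_{X',x'}` is then bijective, so `κ(g x') = κ(x')`. [folklore] -/
private theorem residueDegree_eq_one (hbir : IsBirational g) (x' : X')
    [IsDiscreteValuationRing (X.presheaf.stalk (g.base x'))] : g.residueDegree x' = 1 := by
  have hsurj : Function.Surjective (g.stalkMap x') :=
    surjective_of_dvr (g.stalkMap x').hom (stalkMap_injective g x') (exists_stalkMap_mul_eq g hbir x')
  have hres : Function.Surjective (g.residueFieldMap x') := by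
    intro r
    obtain ⟨t, rfl⟩ := X'.residue_surjective x' r
    obtain ⟨s, rfl⟩ := hsurj t
    refine ⟨X.residue (g.base x') s, ?_⟩
    change (X.residue (g.base x') ≫ g.residueFieldMap x') s = (g.stalkMap x' ≫ X'.residue x') s
    rw [Scheme.residue_residueFieldMap]
  letI := (g.residueFieldMap x').hom.toAlgebra
  have hbij : Function.Bijective
      (algebraMap (X.residueField (g.base x')) (X'.residueField x')) :=
    ⟨(g.residueFieldMap x').hom.injective, hres⟩
  let e := LinearEquiv.ofBijective (Algebra.linearMap (X.residueField (g.base x'))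
    (X'.residueField x')) hbij
  change Module.finrank (X.residueField (g.base x')) (X'.residueField x') = 1
  rw [← e.finrank_eq, Module.finrank_self]

/-! ### Degrees under pull-back along proper dominant morphisms of curves -/

/-- **`deg p^*D = [R(C') : R(C)] · deg D`** for a proper dominant `K`-morphism `p : C' → C` of integral
proper `K`-curves: functoriality of proper push-forward plus `p_*[p^*D] = [R(C'):R(C)] [D]`
(`CartierDivisor.map_cycle_pullback_eq_smul`, Fulton Prop. 2.3 (c)). [folklore] -/
private theorem degree_pullback_eq_mul {K : Type u} [Field K] {C' C : SchemeOver K}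
    [IsIntegral C'.left] [IsIntegral C.left] [IsProper C'.hom] [IsProper C.hom] (p : C' ⟶ C)
    [IsProper p.left] [IsDominant p.left] (hC' : height (⊤ : ↥C'.left) = 1)
    (hC : height (⊤ : ↥C.left) = 1) (D : CartierDivisor C.left) :
    CartierDivisor.degree C' (D.pullback p.left) =
      (letI := (RatFn.functionFieldMap p.left).toAlgebra;
        (Module.finrank C.left.functionField C'.left.functionField : ℤ)) *
        CartierDivisor.degree C D := by
  letI := (RatFn.functionFieldMap p.left).toAlgebra
  have e : (toSpecOver C').left = p.left ≫ (toSpecOver C).left := (Over.w p).symm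
  have hzsmul : ∀ (m : ℤ) (c : AlgebraicCycle C.left ℤ),
      AlgebraicCycle.map (toSpecOver C).left height height (m • c) =
        m • AlgebraicCycle.map (toSpecOver C).left height height c := fun m c =>
    map_zsmul (AddMonoidHom.mk' (AlgebraicCycle.map (toSpecOver C).left height height)
      (algebraicCycleMap_add (toSpecOver C).left height height)) m c
  unfold CartierDivisor.degree
  rw [algebraicCycleMap_congr e, algebraicCycleMap_comp p.left (toSpecOver C).left
    p.left.isClosedMap (toSpecOver C).left.isClosedMap,
    CartierDivisor.map_cycle_pullback_eq_smul p hC' hC D, hzsmul]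
  simp

end Lipman1969_15_a_holds_aux

open Lipman1969_15_a_holds_aux in
/-- **Lipman 1969, §15 a) (p. 227) for an integral exceptional curve and its proper transform**:
`(g^*D · E_{η'}) = (D · E_η)` for `g : X' → X` proper birational, `X'` regular, `η' ↦ η` with
one-dimensional closures. [cite: Lipman1969, Section 15, statement a) (p. 227)] -/
theorem Lipman1969_15_a_holds : Lipman1969_15_a.{u} := by
  intro R _ _ _ _ _ h2 X _ _ f hf X' _ _ g _ hg hbir _hreg D η hη η' hgη hη'1
  subst hgη
  haveI : IsProper f := hf.isProper
  haveI : IsProper g := hg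
  have hη' : η' ∈ excCurvePoints (g ≫ f) := ⟨by rw [Scheme.Hom.comp_apply]; exact hη.1, hη'1⟩
  -- the curves `E = E_η`, `E' = E_{η'}` over `κ(𝔪)` and the restriction `ḡ : E' → E` of `g`
  obtain ⟨q, hq⟩ := exists_fac_specResidueField f hη.1
  obtain ⟨gbar, hfac, hsurj⟩ :=
    ClosedSubvariety.exists_hom_ofPoint_fac g g.isClosedMap η'
  have hq' : (gbar ≫ q) ≫ Spec.map (CommRingCat.ofHom (residue R)) =
      (ClosedSubvariety.ofPoint X' η').ι ≫ (g ≫ f) := by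
    rw [Category.assoc, hq, ← Category.assoc, hfac, Category.assoc]
  haveI : IsIntegral (Over.mk q : SchemeOver (ResidueField R)).left :=
    inferInstanceAs (IsIntegral (ClosedSubvariety.ofPoint X (g.base η')).carrier)
  haveI : IsProper (Over.mk q : SchemeOver (ResidueField R)).hom :=
    isProper_of_fac_specResidueField f hq
  haveI : IsIntegral (Over.mk (gbar ≫ q) : SchemeOver (ResidueField R)).left :=
    inferInstanceAs (IsIntegral (ClosedSubvariety.ofPoint X' η').carrier)
  haveI : IsProper (Over.mk (gbar ≫ q) : SchemeOver (ResidueField R)).hom :=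
    isProper_of_fac_specResidueField (g ≫ f) hq'
  have hC : height (⊤ : ↥(ClosedSubvariety.ofPoint X (g.base η')).carrier) = 1 :=
    height_top_ofPoint_eq_one f hη
  have hC' : height (⊤ : ↥(ClosedSubvariety.ofPoint X' η').carrier) = 1 :=
    height_top_ofPoint_eq_one (g ≫ f) hη'
  rw [excCurveDegree_eq_degree_of_fac (g ≫ f) hq', excCurveDegree_eq_degree_of_fac f hq]
  -- `ḡ` is dominant and proper
  haveI : IsDominant gbar := ⟨hsurj.denseRange⟩
  haveI : IsProper (gbar ≫ (ClosedSubvariety.ofPoint X (g.base η')).ι) := by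
    rw [hfac]; infer_instance
  haveI : IsProper gbar := IsProper.of_comp gbar (ClosedSubvariety.ofPoint X (g.base η')).ι
  -- `ḡ` as a `κ(𝔪)`-morphism `E' → E`
  let p : (Over.mk (gbar ≫ q) : SchemeOver (ResidueField R)) ⟶ Over.mk q := Over.homMk gbar rfl
  haveI : IsProper p.left := inferInstanceAs (IsProper gbar)
  haveI : IsDominant p.left := inferInstanceAs (IsDominant gbar)
  -- `[R(E') : R(E)] = [κ(η') : κ(η)] = 1`
  letI := (RatFn.functionFieldMap gbar).toAlgebra
  have hfin : Module.finrank (ClosedSubvariety.ofPoint X (g.base η')).carrier.functionField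
      (ClosedSubvariety.ofPoint X' η').carrier.functionField = 1 := by
    have h1 := (ClosedSubvariety.ofPoint X' η').residueDegree_eq_finrank_of_fac g
      (ClosedSubvariety.ofPoint X (g.base η')) gbar hfac
    have hgen : (ClosedSubvariety.ofPoint X' η').ι (genericPoint (ClosedSubvariety.ofPoint X' η').carrier)
        = η' := ClosedSubvariety.genericPoint_ofPoint (X := X') (x := η')
    rw [hgen] at h1
    rw [← h1]
    haveI := hf.isRegular (g.base η')
    have hdim : ringKrullDim (X.presheaf.stalk (g.base η')) = 1 := by
      rw [ringKrullDim_stalk_eq_coheight, hf.coheight_eq_one_of_mem_excCurvePoints h2 hη]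
      rfl
    haveI : IsDiscreteValuationRing (X.presheaf.stalk (g.base η')) :=
      Literature.RingTheory.RegularLocalRing.isDiscreteValuationRing_of_ringKrullDim_eq_one hdim
    exact residueDegree_eq_one g hbir η'
  -- the restriction of `g^*D` to `E'` is linearly equivalent to `ḡ^*` of the restriction of `D` to `E`
  have H1 : ((D.pullback g).pullbackRep (ClosedSubvariety.ofPoint X' η').ι).LinEquiv
      (D.classPullback ((ClosedSubvariety.ofPoint X' η').ι ≫ g)) :=
    ((D.pullback g).classPullback_linEquiv_pullbackRep (ClosedSubvariety.ofPoint X' η').ι).symm.trans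
      (((D.classPullback_linEquiv_pullback g).symm.classPullback
        (ClosedSubvariety.ofPoint X' η').ι).trans
        (CartierDivisor.classPullback_comp_linEquiv g (ClosedSubvariety.ofPoint X' η').ι D).symm)
  rw [← hfac] at H1
  have H : ((D.pullback g).pullbackRep (ClosedSubvariety.ofPoint X' η').ι).LinEquiv
      ((D.pullbackRep (ClosedSubvariety.ofPoint X (g.base η')).ι).pullback gbar) :=
    H1.trans ((CartierDivisor.classPullback_comp_linEquiv
      (ClosedSubvariety.ofPoint X (g.base η')).ι gbar D).trans
      (((D.classPullback_linEquiv_pullbackRep (ClosedSubvariety.ofPoint X (g.base η')).ι).classPullback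
        gbar).trans
        ((D.pullbackRep (ClosedSubvariety.ofPoint X (g.base η')).ι).classPullback_linEquiv_pullback
          gbar)))
  have hdeg : CartierDivisor.degree (Over.mk (gbar ≫ q) : SchemeOver (ResidueField R))
      (((D.pullbackRep (ClosedSubvariety.ofPoint X (g.base η')).ι).pullback gbar :
        CartierDivisor (ClosedSubvariety.ofPoint X' η').carrier)) =
      (Module.finrank (ClosedSubvariety.ofPoint X (g.base η')).carrier.functionField
        (ClosedSubvariety.ofPoint X' η').carrier.functionField : ℤ) *
        CartierDivisor.degree (Over.mk q : SchemeOver (ResidueField R))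
          (D.pullbackRep (ClosedSubvariety.ofPoint X (g.base η')).ι) :=
    degree_pullback_eq_mul p hC' hC (D.pullbackRep (ClosedSubvariety.ofPoint X (g.base η')).ι)
  rw [hfin, Nat.cast_one, one_mul] at hdeg
  exact (CartierDivisor.LinEquiv.degree_eq (C := Over.mk (gbar ≫ q)) hC' H).trans hdeg

end Literature.AlgebraicGeometry.Resolution

end
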